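import Mathlib.RepresentationTheory.Basic
import Mathlib.RingTheory.Finiteness.Bilinear
import Mathlib.LinearAlgebra.FiniteDimensional.Basic
import Mathlib.LinearAlgebra.Span.Basic

/-!
# K-finiteness is preserved by a normalised space of operators (Tier 5, N4.3 (A3) STEP 6)

Kernel form of the sentence of route/T5-N4-p5.md (A3) STEP 6 (l. 147):

«… hence `𝔤_∞` acts on `M`; K-finiteness is preserved by `𝔤_∞` (which commutes with `K_f^max`
and normalises the `K_∞`-action on smooth vectors) …»

Abstract setting: a representation `ρ` of a group `K` on a `k`-vector space `V` and a
finite-dimensional subspace `𝔤 ⊆ End_k(V)` of operators which `K` NORMALISES, i.e.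
`ρ κ * X * ρ κ⁻¹ ∈ 𝔤` for all `κ ∈ K`, `X ∈ 𝔤` (for the Lie algebra action this is
`ρ(κ) dπ(X) ρ(κ)⁻¹ = dπ(Ad(κ) X)`). A vector `v` is `K`-FINITE when the span of its orbit
`span k (range fun κ => ρ κ v)` is finite-dimensional (the convention of
`T5KFiniteCommensurable`). Then:

* `ρ κ (X v) = (ρ κ * X * ρ κ⁻¹) (ρ κ v)` (`rep_conj_apply`), so the orbit span of `X v` lies in
  `𝔤 · span(K·v)` = `Submodule.map₂ LinearMap.id 𝔤 (span k (range fun κ => ρ κ v))`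
  (`span_orbit_apply_le_map₂`);
* `𝔤 · S` is finite-dimensional when `𝔤` and `S` are (`finiteDimensional_map₂`, from Mathlib's
  `Submodule.FG.map₂`);
* hence `X v` is `K`-finite whenever `v` is (`finiteDimensional_span_orbit_apply_of_normalises`).

The two ways the prose uses this are both covered: an operator that COMMUTES with `K`
(`𝔤_∞` and `K_f^max`) satisfies the normalising condition with `𝔤 = k·X`
(`normalises_of_comm`, and directly `finiteDimensional_span_orbit_apply_of_comm`), and for a
product group `K₁ × K₂` with `𝔤` normalised by `K₁` and centralised by `K₂` (`K_∞ × K_f^max`)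
the whole product normalises `𝔤` (`normalises_prod`, `finiteDimensional_span_orbit_apply_prod`).

Everything is Mathlib-only; no topology, no Lie algebra structure on `𝔤` is needed (only that it
is a finite-dimensional subspace of `End_k(V)` stable under conjugation by `K`).
-/

namespace Summit.Ventures.HodgeRepro2.T5KFiniteNormalised

open Submodule Set

variable {k V K : Type*} [Field k] [AddCommGroup V] [Module k V] [Group K]

/-- `ρ κ⁻¹` undoes `ρ κ`. -/
theorem rep_inv_apply_apply_self (ρ : Representation k K V) (κ : K) (v : V) : ρ κ⁻¹ (ρ κ v) = v := by
  rw [← Module.End.mul_apply, ← map_mul, inv_mul_cancel, map_one, Module.End.one_apply]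

/-- **Conjugation formula.** `ρ κ (X v) = (ρ κ * X * ρ κ⁻¹) (ρ κ v)`: moving `ρ κ` past `X`
replaces `X` by its conjugate `ρ κ * X * ρ κ⁻¹` (= `dπ(Ad(κ) X)` for a Lie algebra action). -/
theorem rep_conj_apply (ρ : Representation k K V) (κ : K) (X : Module.End k V) (v : V) :
    ρ κ (X v) = (ρ κ * X * ρ κ⁻¹) (ρ κ v) := by
  rw [Module.End.mul_apply, Module.End.mul_apply, rep_inv_apply_apply_self]

/-- **The orbit span of `X v` lies in `𝔤 · span(K·v)`** when `K` normalises `𝔤 ∋ X`: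
`ρ κ (X v) = (ρ κ * X * ρ κ⁻¹) (ρ κ v)` with `ρ κ * X * ρ κ⁻¹ ∈ 𝔤` and `ρ κ v ∈ span(K·v)`.
Here `𝔤 · S` is Mathlib's `Submodule.map₂ LinearMap.id 𝔤 S`, the span of `{Y s | Y ∈ 𝔤, s ∈ S}`. -/
theorem span_orbit_apply_le_map₂ (ρ : Representation k K V) {𝔤 : Submodule k (Module.End k V)}
    (hN : ∀ (κ : K) (X : Module.End k V), X ∈ 𝔤 → ρ κ * X * ρ κ⁻¹ ∈ 𝔤)
    {X : Module.End k V} (hX : X ∈ 𝔤) (v : V) :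
    span k (range fun κ : K => ρ κ (X v)) ≤
      map₂ (LinearMap.id : Module.End k V →ₗ[k] Module.End k V) 𝔤
        (span k (range fun κ : K => ρ κ v)) := by
  refine span_le.mpr ?_
  rintro _ ⟨κ, rfl⟩
  show ρ κ (X v) ∈ _
  rw [rep_conj_apply]
  exact apply_mem_map₂ _ (hN κ X hX) (subset_span ⟨κ, rfl⟩)

/-- **`𝔤 · S` is finite-dimensional** when `𝔤` and `S` are: the image of two finitely generated
submodules under a bilinear map is finitely generated (Mathlib's `Submodule.FG.map₂`). -/
theorem finiteDimensional_map₂ {M N P : Type*} [AddCommGroup M] [Module k M] [AddCommGroup N]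
    [Module k N] [AddCommGroup P] [Module k P] (f : M →ₗ[k] N →ₗ[k] P)
    (p : Submodule k M) (q : Submodule k N) [FiniteDimensional k p] [FiniteDimensional k q] :
    FiniteDimensional k (map₂ f p q) :=
  Module.Finite.of_fg ((Module.Finite.iff_fg.mp ‹_›).map₂ f (Module.Finite.iff_fg.mp ‹_›))

/-- **K-finiteness is preserved by a normalised finite-dimensional space of operators.**
If `K` normalises the finite-dimensional `𝔤 ⊆ End_k(V)` and `v` is `K`-finite
(its orbit span is finite-dimensional), then `X v` is `K`-finite for every `X ∈ 𝔤`. -/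
theorem finiteDimensional_span_orbit_apply_of_normalises (ρ : Representation k K V)
    {𝔤 : Submodule k (Module.End k V)} [FiniteDimensional k 𝔤]
    (hN : ∀ (κ : K) (X : Module.End k V), X ∈ 𝔤 → ρ κ * X * ρ κ⁻¹ ∈ 𝔤)
    {X : Module.End k V} (hX : X ∈ 𝔤) (v : V)
    [FiniteDimensional k (span k (range fun κ : K => ρ κ v))] :
    FiniteDimensional k (span k (range fun κ : K => ρ κ (X v))) :=
  haveI := finiteDimensional_map₂ (LinearMap.id : Module.End k V →ₗ[k] Module.End k V) 𝔤
    (span k (range fun κ : K => ρ κ v))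
  Submodule.finiteDimensional_of_le (span_orbit_apply_le_map₂ ρ hN hX v)

/-- The `K`-finite vectors are stable under every `X` of a normalised finite-dimensional `𝔤`
(the same statement with the finiteness as an explicit hypothesis rather than an instance). -/
theorem finiteDimensional_span_orbit_apply_of_normalises' (ρ : Representation k K V)
    {𝔤 : Submodule k (Module.End k V)} [FiniteDimensional k 𝔤]
    (hN : ∀ (κ : K) (X : Module.End k V), X ∈ 𝔤 → ρ κ * X * ρ κ⁻¹ ∈ 𝔤)
    {X : Module.End k V} (hX : X ∈ 𝔤) (v : V)
    (hv : FiniteDimensional k (span k (range fun κ : K => ρ κ v))) :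
    FiniteDimensional k (span k (range fun κ : K => ρ κ (X v))) :=
  haveI := hv
  finiteDimensional_span_orbit_apply_of_normalises ρ hN hX v

section Commuting

/-- An operator commuting with `K` is normalised by `K`: `ρ κ * X * ρ κ⁻¹ = X`. -/
theorem conj_eq_self_of_comm (ρ : Representation k K V) {X : Module.End k V}
    (hC : ∀ κ : K, ρ κ * X = X * ρ κ) (κ : K) : ρ κ * X * ρ κ⁻¹ = X := by
  rw [hC κ, mul_assoc, ← map_mul, mul_inv_cancel, map_one, mul_one]

/-- The line `k · X` spanned by an operator commuting with `K` is normalised by `K`. -/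
theorem normalises_of_comm (ρ : Representation k K V) {X : Module.End k V}
    (hC : ∀ κ : K, ρ κ * X = X * ρ κ) (κ : K) (Y : Module.End k V)
    (hY : Y ∈ span k ({X} : Set (Module.End k V))) :
    ρ κ * Y * ρ κ⁻¹ ∈ span k ({X} : Set (Module.End k V)) := by
  obtain ⟨c, rfl⟩ := mem_span_singleton.mp hY
  rw [mul_smul_comm, smul_mul_assoc, conj_eq_self_of_comm ρ hC κ]
  exact mem_span_singleton.mpr ⟨c, rfl⟩

/-- **An operator commuting with `K` maps the orbit span of `v` onto the orbit span of `X v`:**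
`span(K · X v) = X (span(K · v))`. -/
theorem span_orbit_apply_eq_map_of_comm (ρ : Representation k K V) {X : Module.End k V}
    (hC : ∀ κ : K, ρ κ * X = X * ρ κ) (v : V) :
    span k (range fun κ : K => ρ κ (X v)) = (span k (range fun κ : K => ρ κ v)).map X := by
  rw [map_span, ← range_comp']
  congr 2
  funext κ
  simp only [← Module.End.mul_apply, hC κ]

/-- **K-finiteness is preserved by an operator commuting with `K`** (`𝔤_∞` and `K_f^max` in
STEP 6): `span(K · X v) = X (span(K · v))` is the image of a finite-dimensional space. -/
theorem finiteDimensional_span_orbit_apply_of_comm (ρ : Representation k K V)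
    {X : Module.End k V} (hC : ∀ κ : K, ρ κ * X = X * ρ κ) (v : V)
    [FiniteDimensional k (span k (range fun κ : K => ρ κ v))] :
    FiniteDimensional k (span k (range fun κ : K => ρ κ (X v))) := by
  rw [span_orbit_apply_eq_map_of_comm ρ hC v]
  infer_instance

end Commuting

section Prod

variable {K₁ K₂ : Type*} [Group K₁] [Group K₂]

/-- `ρ (κ₁, κ₂) = ρ (κ₁, 1) * ρ (1, κ₂)` for a representation of a product group. -/
theorem apply_prod_eq_mul (ρ : Representation k (K₁ × K₂) V) (κ : K₁ × K₂) :
    ρ κ = ρ (κ.1, 1) * ρ (1, κ.2) := by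
  rw [← map_mul, Prod.mk_mul_mk, mul_one, one_mul]

/-- `ρ (κ₁, κ₂)⁻¹ = ρ (1, κ₂⁻¹) * ρ (κ₁⁻¹, 1)`. -/
theorem apply_prod_inv_eq_mul (ρ : Representation k (K₁ × K₂) V) (κ : K₁ × K₂) :
    ρ κ⁻¹ = ρ (1, κ.2⁻¹) * ρ (κ.1⁻¹, 1) := by
  rw [← map_mul, Prod.mk_mul_mk, mul_one, one_mul, Prod.inv_mk]

/-- **A product group normalises `𝔤`** as soon as the first factor normalises it and the second
factor centralises it (STEP 6: `𝔤_∞` is normalised by `K_∞` and commutes with `K_f^max`, so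
`K = K_∞ × K_f^max` normalises `𝔤_∞`). -/
theorem normalises_prod (ρ : Representation k (K₁ × K₂) V) {𝔤 : Submodule k (Module.End k V)}
    (h₁ : ∀ (κ₁ : K₁) (X : Module.End k V), X ∈ 𝔤 → ρ (κ₁, 1) * X * ρ (κ₁⁻¹, 1) ∈ 𝔤)
    (h₂ : ∀ (κ₂ : K₂) (X : Module.End k V), X ∈ 𝔤 → ρ (1, κ₂) * X = X * ρ (1, κ₂))
    (κ : K₁ × K₂) (X : Module.End k V) (hX : X ∈ 𝔤) : ρ κ * X * ρ κ⁻¹ ∈ 𝔤 := by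
  have e4 : ρ (1, κ.2) * ρ (1, κ.2⁻¹) = 1 := by
    rw [← map_mul, Prod.mk_mul_mk, mul_one, mul_inv_cancel]
    exact map_one ρ
  have : ρ κ * X * ρ κ⁻¹ = ρ (κ.1, 1) * X * ρ (κ.1⁻¹, 1) := by
    calc ρ κ * X * ρ κ⁻¹
        = ρ (κ.1, 1) * ((ρ (1, κ.2) * X) * ρ (1, κ.2⁻¹)) * ρ (κ.1⁻¹, 1) := by
          rw [apply_prod_eq_mul, apply_prod_inv_eq_mul]
          simp only [mul_assoc]
      _ = ρ (κ.1, 1) * (X * (ρ (1, κ.2) * ρ (1, κ.2⁻¹))) * ρ (κ.1⁻¹, 1) := by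
          rw [h₂ κ.2 X hX, mul_assoc X]
      _ = ρ (κ.1, 1) * X * ρ (κ.1⁻¹, 1) := by rw [e4, mul_one]
  rw [this]
  exact h₁ κ.1 X hX

/-- **STEP 6 for `K = K₁ × K₂`:** if the finite-dimensional `𝔤` is normalised by `K₁` and
centralised by `K₂`, then `X v` is `K`-finite whenever `v` is, for every `X ∈ 𝔤`. -/
theorem finiteDimensional_span_orbit_apply_prod (ρ : Representation k (K₁ × K₂) V)
    {𝔤 : Submodule k (Module.End k V)} [FiniteDimensional k 𝔤]
    (h₁ : ∀ (κ₁ : K₁) (X : Module.End k V), X ∈ 𝔤 → ρ (κ₁, 1) * X * ρ (κ₁⁻¹, 1) ∈ 𝔤)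
    (h₂ : ∀ (κ₂ : K₂) (X : Module.End k V), X ∈ 𝔤 → ρ (1, κ₂) * X = X * ρ (1, κ₂))
    {X : Module.End k V} (hX : X ∈ 𝔤) (v : V)
    [FiniteDimensional k (span k (range fun κ : K₁ × K₂ => ρ κ v))] :
    FiniteDimensional k (span k (range fun κ : K₁ × K₂ => ρ κ (X v))) :=
  finiteDimensional_span_orbit_apply_of_normalises ρ (normalises_prod ρ h₁ h₂) hX v

end Prod

end Summit.Ventures.HodgeRepro2.T5KFiniteNormalised
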